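import Mathlib
import Literature.Computability.AlgebraicComplexity.OrbitClosureWeights
import Literature.Computability.AlgebraicComplexity.Hyperdeterminant
import Literature.Computability.AlgebraicComplexity.PlethysmStability
import Literature.NumberTheory.DiophantineGeometry.SchurWeylPlethysmCoordRepWeightsProofs
import Summits.ValiantsHypothesis.ValiantsHypothesis.Theorems.ValuativeGCTValuativeFlipBinaryShear

/-!
# Tschirnhaus seeds: explicit two-row highest-weight vectors of `k[Sym^m k^σ]`
(explicit highest-weight-vector axis of `stub_seedRichness`, crux `ValuativeGCT.ValuativeFlip`,
stmt-ValiantsHypothesis-12624; wall-breaker k1)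

Let `σ` be a finite linearly ordered alphabet with top letter `x` and next-to-top letter `y`, and
`m ≥ 1`.  A polynomial function on forms `q` of degree `m` that only reads the coefficients
`α_j(q) = coeff_{y^j x^{m-j}}(q)` sees `q` through its restriction `q(0, …, 0, y, x)` to the last two
letters (`ts_coeff_eq_coeff_res`), and upper triangular substitutions of `σ` restrict to upper
triangular `2 × 2` substitutions of `(y, x)` (`ts_res_linSubst`).  Hence every seminvariant of binary
forms of degree `m` gives a highest-weight vector of `coordRep σ K m`.  We carry this out for the
**Tschirnhaus polynomials** of `…BinaryShear`: the explicit polynomial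

  `F_r = C(m,r) (-X₁)^r + ∑_{i<r} C(m-i-1, r-i-1) m^{i+1} (-X₁)^{r-i-1} X₀^i X_{i+1}`
  (`X_j` the coordinate `X_{y^j x^{m-j}}` of `k[Sym^m]`; degree `r`, isobaric weight `r`)

satisfies `α₀ · F_r(q) = T_r(q|_{y,x})` (`ts_coeff_zero_mul_val`) and is a HIGHEST-WEIGHT VECTOR of
`coordRep σ K m` of weight `-((m-1) r) ε_x - r ε_y` (`ts_tschPoly_mem_highestWeightSpace`) — the dual
weight of the two-row partition `((m-1) r, r) ⊢ m r`, on the ray of `(m-1, 1)`.  These are the seeds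
evaluated on the padded permanent in `…PaddedPerSeeds`.

No definitions and no notation: the coordinate `X_{y^j x^{m-j}}` is written with the junk-safe index
`⟨single y (min j m) + single x (m - min j m), ts_deg_mem x y m j⟩ : DegIdx σ m`.
Sources: Elliott, *Algebra of Quantics* (1895) §§126–130 (seminvariants, protomorphs); BIP 2019 §4
(inheritance to the top letters); folklore.
-/

set_option linter.dupNamespace false

namespace Summit.ValiantsHypothesis.ValiantsHypothesis.Theorems.ValuativeFlip

open MvPolynomial Literature.NumberTheory.DiophantineGeometry
open Literature.Computability.AlgebraicComplexity
open scoped BigOperators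

noncomputable section

variable {σ : Type*} [Fintype σ] [LinearOrder σ] {K : Type*} [Field K]

/-! ## Two-letter coordinates of `k[Sym^m k^σ]` -/

/-- The junk-safe two-letter exponent `y^{min j m} x^{m - min j m}` has degree `m`. [folklore] -/
theorem ts_deg_mem (x y : σ) (m j : ℕ) :
    Finsupp.single y (min j m) + Finsupp.single x (m - min j m) ∈ degMonomials σ m := by
  rw [mem_degMonomials_iff, map_add, Finsupp.degree_single, Finsupp.degree_single]
  omega

omit [Fintype σ] [LinearOrder σ] in
/-- Two-letter exponent vectors are determined by their two entries (`y ≠ x`). [folklore] -/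
theorem ts_single_add_single_inj {x y : σ} (hyx : y ≠ x) (a b a' b' : ℕ) :
    (Finsupp.single y a + Finsupp.single x b : σ →₀ ℕ) = Finsupp.single y a' + Finsupp.single x b' ↔
      a = a' ∧ b = b' := by
  constructor
  · intro h
    have h0 := congrArg (fun e => e y) h
    have h1 := congrArg (fun e => e x) h
    simp only [Finsupp.coe_add, Pi.add_apply, Finsupp.single_eq_same, Finsupp.single_eq_of_ne hyx,
      Finsupp.single_eq_of_ne hyx.symm, add_zero, zero_add] at h0 h1
    exact ⟨h0, h1⟩
  · rintro ⟨rfl, rfl⟩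
    rfl

/-! ## Restriction to the last two letters -/

/-- **Upper triangular substitutions restrict to the top two letters.** For `B` upper triangular
(`B i j = 0` for `j < i`), `x` the top letter and `y` its predecessor, restricting `B · q` to
`(y, x)` is the `2 × 2` upper triangular substitution `(B_yy, B_yx; 0, B_xx)` applied to the restriction
of `q` (upper triangular matrices only lower indices). [folklore; BIP 2019 §4] -/
theorem ts_res_linSubst {x y : σ} (hyx : y < x) (htop : ∀ i, i ≤ x) (hpred : ∀ i, i < x → i ≤ y)
    (B : Matrix σ σ K) (hB : ∀ i j, j < i → B i j = 0) (q : MvPolynomial σ K) :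
    (aeval fun i : σ => if i = x then (X 1 : MvPolynomial (Fin 2) K) else if i = y then (X 0 : MvPolynomial (Fin 2) K) else 0) (linSubst σ K B q) =
      linSubst (Fin 2) K !![B y y, B y x; 0, B x x] ((aeval fun i : σ => if i = x then (X 1 : MvPolynomial (Fin 2) K) else if i = y then (X 0 : MvPolynomial (Fin 2) K) else 0) q) := by
  have hne : y ≠ x := ne_of_lt hyx
  suffices h : ((aeval fun i : σ => if i = x then (X 1 : MvPolynomial (Fin 2) K) else if i = y then (X 0 : MvPolynomial (Fin 2) K) else 0)).comp (linSubst σ K B) =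
      (linSubst (Fin 2) K !![B y y, B y x; 0, B x x]).comp (aeval fun i : σ => if i = x then (X 1 : MvPolynomial (Fin 2) K) else if i = y then (X 0 : MvPolynomial (Fin 2) K) else 0) from
    congrArg (fun φ => φ q) h
  apply MvPolynomial.algHom_ext
  intro i
  rw [AlgHom.comp_apply, AlgHom.comp_apply, linSubst_X, map_sum]
  simp only [map_smul, aeval_X]
  -- the left-hand sum has two nonzero terms
  have hsum : ∑ j : σ, B j i • (if j = x then (X 1 : MvPolynomial (Fin 2) K)
      else if j = y then (X 0 : MvPolynomial (Fin 2) K) else 0) = B x i • X 1 + B y i • X 0 := by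
    have hterm : ∀ j : σ, B j i • (if j = x then (X 1 : MvPolynomial (Fin 2) K)
        else if j = y then (X 0 : MvPolynomial (Fin 2) K) else 0) =
        (if j = x then B j i • (X 1 : MvPolynomial (Fin 2) K) else 0) +
          (if j = y then B j i • (X 0 : MvPolynomial (Fin 2) K) else 0) := by
      intro j
      by_cases hjx : j = x
      · subst hjx; rw [if_pos rfl, if_pos rfl, if_neg hne.symm, add_zero]
      · rw [if_neg hjx, if_neg hjx, zero_add]
        by_cases hjy : j = y
        · rw [if_pos hjy, if_pos hjy]
        · rw [if_neg hjy, if_neg hjy, smul_zero]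
    simp only [hterm, Finset.sum_add_distrib, Finset.sum_ite_eq', Finset.mem_univ, if_true]
  rw [hsum]
  by_cases hix : i = x
  · subst hix
    rw [if_pos rfl, linSubst_X, Fin.sum_univ_two]
    simp only [Matrix.of_apply, Matrix.cons_val', Matrix.cons_val_zero, Matrix.cons_val_one,
      Matrix.cons_val_fin_one]
    rw [add_comm]
  · rw [if_neg hix]
    by_cases hiy : i = y
    · subst hiy
      rw [if_pos rfl, linSubst_X, Fin.sum_univ_two, hB x i hyx]
      simp
    · rw [if_neg hiy, map_zero]
      have hix' : i < x := lt_of_le_of_ne (htop i) hix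
      have hiy' : i < y := lt_of_le_of_ne (hpred i hix') hiy
      rw [hB x i hix', hB y i hiy']
      simp

omit [Fintype σ] in
/-- **Two-letter coefficients are read off the restriction**: `coeff_{y^r x^s}(q)` is the coefficient of
`X₀^r X₁^s` in `q(0, …, 0, X₀, X₁)`. [folklore] -/
theorem ts_coeff_eq_coeff_res {x y : σ} (hyx : y ≠ x) (q : MvPolynomial σ K) (r s : ℕ) :
    coeff (Finsupp.single y r + Finsupp.single x s) q =
      coeff (Finsupp.single 0 r + Finsupp.single 1 s) ((aeval fun i : σ => if i = x then (X 1 : MvPolynomial (Fin 2) K) else if i = y then (X 0 : MvPolynomial (Fin 2) K) else 0) q) := by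
  induction q using MvPolynomial.induction_on' with
  | add p q hp hq => rw [coeff_add, map_add, coeff_add, hp, hq]
  | monomial e c =>
    rw [coeff_monomial, aeval_monomial]
    by_cases hsupp : ∀ i, i ≠ x → i ≠ y → e i = 0
    · -- `e` is supported on `{y, x}`
      have he : e = Finsupp.single y (e y) + Finsupp.single x (e x) := by
        ext i
        rw [Finsupp.add_apply]
        by_cases hiy : i = y
        · rw [hiy, Finsupp.single_eq_same, Finsupp.single_eq_of_ne hyx, add_zero]
        · by_cases hix : i = x
          · rw [hix, Finsupp.single_eq_same, Finsupp.single_eq_of_ne hyx.symm, zero_add]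
          · rw [Finsupp.single_eq_of_ne hiy, Finsupp.single_eq_of_ne hix, hsupp i hix hiy, add_zero]
      have hsub : e.support ⊆ ({y, x} : Finset σ) := by
        intro i hi
        rw [Finsupp.mem_support_iff] at hi
        rw [Finset.mem_insert, Finset.mem_singleton]
        by_contra h
        push Not at h
        exact hi (hsupp i h.2 h.1)
      have hiff : e = Finsupp.single y r + Finsupp.single x s ↔ e y = r ∧ e x = s := by
        constructor
        · intro h
          exact ⟨by rw [h, Finsupp.add_apply, Finsupp.single_eq_same, Finsupp.single_eq_of_ne hyx, add_zero],
            by rw [h, Finsupp.add_apply, Finsupp.single_eq_of_ne hyx.symm, Finsupp.single_eq_same, zero_add]⟩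
        · rintro ⟨h1, h2⟩
          rw [he, h1, h2]
      rw [Finsupp.prod_of_support_subset e hsub _ (fun i _ => pow_zero _), Finset.prod_pair hyx,
        if_neg hyx, if_pos rfl, if_pos rfl]
      rw [show (algebraMap K (MvPolynomial (Fin 2) K)) c = C c from rfl, bs_coeff_C_mul_X_pow_mul_X_pow]
      by_cases h : e y = r ∧ e x = s
      · rw [if_pos (hiff.mpr h), if_pos h]
      · rw [if_neg (mt hiff.mp h), if_neg h]
    · -- some other letter occurs: both sides vanish
      push Not at hsupp
      obtain ⟨i, hix, hiy, hi⟩ := hsupp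
      have hne' : ¬ e = Finsupp.single y r + Finsupp.single x s := by
        intro h
        have := congrArg (fun f => f i) h
        simp only [Finsupp.coe_add, Pi.add_apply, Finsupp.single_eq_of_ne hiy, Finsupp.single_eq_of_ne hix,
          add_zero] at this
        exact hi this
      have hprod : e.prod (fun j k => (if j = x then (X 1 : MvPolynomial (Fin 2) K)
          else if j = y then (X 0 : MvPolynomial (Fin 2) K) else 0) ^ k) = 0 := by
        rw [Finsupp.prod, Finset.prod_eq_zero_iff]
        exact ⟨i, Finsupp.mem_support_iff.mpr hi, by rw [if_neg hix, if_neg hiy]; exact zero_pow hi⟩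
      rw [if_neg hne', hprod, mul_zero, coeff_zero]

omit [Fintype σ] in
/-- Restriction to two letters preserves homogeneity of degree `m`. [folklore] -/
theorem ts_res_isHomogeneous {x y : σ} {m : ℕ} {q : MvPolynomial σ K}
    (hq : q.IsHomogeneous m) :
    ((aeval fun i : σ => if i = x then (X 1 : MvPolynomial (Fin 2) K)
      else if i = y then (X 0 : MvPolynomial (Fin 2) K) else 0) q).IsHomogeneous m := by
  have h1 : ∀ i : σ, (if i = x then (X 1 : MvPolynomial (Fin 2) K)
      else if i = y then (X 0 : MvPolynomial (Fin 2) K) else 0).IsHomogeneous 1 := by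
    intro i
    split_ifs
    · exact isHomogeneous_X K 1
    · exact isHomogeneous_X K 0
    · exact isHomogeneous_zero _ _ _
  simpa using hq.aeval _ h1

/-! ## The Tschirnhaus polynomial `F_r` and its values -/

/-- The junk-safe coordinate `X_{y^j x^{m-j}}` evaluated at a form `q` is the `j`-th binary coefficient of
the restriction of `q` (`j ≤ m`). [folklore] -/
theorem ts_formCoeff_DI {x y : σ} (hyx : y ≠ x) {m : ℕ} (q : MvPolynomial σ K) {j : ℕ} (hj : j ≤ m) :
    formCoeff m q (⟨Finsupp.single y (min j m) + Finsupp.single x (m - min j m), ts_deg_mem x y m j⟩ : DegIdx σ m) = coeff (Finsupp.single 0 j + Finsupp.single 1 (m - j)) ((aeval fun i : σ => if i = x then (X 1 : MvPolynomial (Fin 2) K) else if i = y then (X 0 : MvPolynomial (Fin 2) K) else 0) q) := by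
  rw [formCoeff_apply]
  show coeff (Finsupp.single y (min j m) + Finsupp.single x (m - min j m)) q = _
  rw [min_eq_left hj]
  exact ts_coeff_eq_coeff_res hyx q j (m - j)

/-- **Values of the Tschirnhaus polynomial.** For `q` a form of degree `m ≥ 1` and `r ≤ m`, the value
of `F_r` at `q` is the polynomial `C(m,r)(-α₁)^r + ∑_{i<r} C(m-i-1,r-i-1) m^{i+1} (-α₁)^{r-i-1} α₀^i α_{i+1}`
in the binary coefficients `α_j` of the restriction `q(0,…,0,y,x)`. [folklore] -/
theorem ts_aeval_formCoeff_tschPoly {x y : σ} (hyx : y < x) {m : ℕ} (hm1 : 1 ≤ m)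
    (q : MvPolynomial σ K) {r : ℕ} (hr : r ≤ m) :
    aeval (formCoeff m q) (C ((Nat.choose m r : ℕ) : K) * (-X (⟨Finsupp.single y (min 1 m) + Finsupp.single x (m - min 1 m), ts_deg_mem x y m 1⟩ : DegIdx σ m)) ^ r + ∑ i ∈ Finset.range r, C ((Nat.choose (m - (i + 1)) (r - (i + 1)) * m ^ (i + 1) : ℕ) : K) * ((-X (⟨Finsupp.single y (min 1 m) + Finsupp.single x (m - min 1 m), ts_deg_mem x y m 1⟩ : DegIdx σ m)) ^ (r - (i + 1)) * X (⟨Finsupp.single y (min 0 m) + Finsupp.single x (m - min 0 m), ts_deg_mem x y m 0⟩ : DegIdx σ m) ^ i * X (⟨Finsupp.single y (min (i + 1) m) + Finsupp.single x (m - min (i + 1) m), ts_deg_mem x y m (i + 1)⟩ : DegIdx σ m))) = (((Nat.choose m r : ℕ) : K) * (-(coeff (Finsupp.single 0 1 + Finsupp.single 1 (m - 1)) ((aeval fun i : σ => if i = x then (X 1 : MvPolynomial (Fin 2) K) else if i = y then (X 0 : MvPolynomial (Fin 2) K) else 0) q))) ^ r + ∑ i ∈ Finset.range r, ((Nat.choose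 (m - (i + 1)) (r - (i + 1)) * m ^ (i + 1) : ℕ) : K) * ((-(coeff (Finsupp.single 0 1 + Finsupp.single 1 (m - 1)) ((aeval fun i : σ => if i = x then (X 1 : MvPolynomial (Fin 2) K) else if i = y then (X 0 : MvPolynomial (Fin 2) K) else 0) q))) ^ (r - (i + 1)) * (coeff (Finsupp.single 0 0 + Finsupp.single 1 (m - 0)) ((aeval fun i : σ => if i = x then (X 1 : MvPolynomial (Fin 2) K) else if i = y then (X 0 : MvPolynomial (Fin 2) K) else 0) q)) ^ i * coeff (Finsupp.single 0 (i + 1) + Finsupp.single 1 (m - (i + 1))) ((aeval fun i : σ => if i = x then (X 1 : MvPolynomial (Fin 2) K) else if i = y then (X 0 : MvPolynomial (Fin 2) K) else 0) q))) := by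
  have hne : y ≠ x := ne_of_lt hyx
  have hco : ∀ j : ℕ, j ≤ m → aeval (formCoeff m q) (X (⟨Finsupp.single y (min j m) + Finsupp.single x (m - min j m), ts_deg_mem x y m j⟩ : DegIdx σ m) : MvPolynomial (DegIdx σ m) K) =
      coeff (Finsupp.single 0 j + Finsupp.single 1 (m - j)) ((aeval fun i : σ => if i = x then (X 1 : MvPolynomial (Fin 2) K) else if i = y then (X 0 : MvPolynomial (Fin 2) K) else 0) q) := by
    intro j hj
    rw [aeval_X, ts_formCoeff_DI hne q hj]
  simp only [map_add, map_sum, map_mul, map_pow, map_neg, aeval_C, Algebra.algebraMap_self_apply]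
  rw [hco 1 hm1, hco 0 (Nat.zero_le m), add_right_inj]
  refine Finset.sum_congr rfl fun i hi => ?_
  rw [Finset.mem_range] at hi
  rw [hco (i + 1) (by omega)]

/-- **`α₀ · F_r = T_r`**: multiplying the value of `F_r` by the leading binary coefficient gives the
Tschirnhaus polynomial `T_r` of `…BinaryShear` (splitting off the `i = 0` term). [folklore] -/
theorem ts_coeff_zero_mul_val (m r : ℕ) (q2 : MvPolynomial (Fin 2) K) :
    coeff (Finsupp.single 0 0 + Finsupp.single 1 (m - 0)) q2 * (((Nat.choose m r : ℕ) : K) * (-(coeff (Finsupp.single 0 1 + Finsupp.single 1 (m - 1)) q2)) ^ r + ∑ i ∈ Finset.range r, ((Nat.choose (m - (i + 1)) (r - (i + 1)) * m ^ (i + 1) : ℕ) : K) * ((-(coeff (Finsupp.single 0 1 + Finsupp.single 1 (m - 1)) q2)) ^ (r - (i + 1)) * (coeff (Finsupp.single 0 0 + Finsupp.single 1 (m - 0)) q2) ^ i * coeff (Finsupp.single 0 (i + 1) + Finsupp.single 1 (m - (i + 1))) q2)) = (∑ i ∈ Finset.range (r + 1), ((Nat.choose (m - i) (r - i) : ℕ)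 : K) * (-(coeff (Finsupp.single 0 1 + Finsupp.single 1 (m - 1)) q2)) ^ (r - i) * (((m : ℕ) : K) * coeff (Finsupp.single 0 0 + Finsupp.single 1 (m - 0)) q2) ^ i * coeff (Finsupp.single 0 i + Finsupp.single 1 (m - i)) q2) := by
  rw [Finset.sum_range_succ', mul_add, Finset.mul_sum, add_comm]
  congr 1
  · refine Finset.sum_congr rfl fun i _ => ?_
    push_cast
    ring
  · simp only [Nat.sub_zero, pow_zero, mul_one]
    ring

/-! ## `F_r` is a highest-weight vector -/

/-- The weight character of the two-row weight `-((m-1) r) ε_x - r ε_y` on an upper triangular `b`: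
`(b_xx^{(m-1) r})⁻¹ (b_yy^r)⁻¹`. [folklore] -/
theorem ts_weightChar_twoRow {x y : σ} (hyx : y ≠ x) (m r : ℕ) (b : GL σ K) :
    weightChar (fun i : σ => if i = x then -(((m - 1) * r : ℕ) : ℤ) else if i = y then -((r : ℕ) : ℤ) else 0) b =
      ((b : Matrix σ σ K) x x ^ ((m - 1) * r))⁻¹ * ((b : Matrix σ σ K) y y ^ r)⁻¹ := by
  rw [weightChar, Finset.prod_eq_mul x y hyx.symm]
  · simp only [if_true, if_neg hyx, zpow_neg, zpow_natCast]
  · intro i _ hi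
    rw [if_neg hi.1, if_neg hi.2, zpow_zero]
  · exact fun h => absurd (Finset.mem_univ x) h
  · exact fun h => absurd (Finset.mem_univ y) h

/-- **The Tschirnhaus polynomial `F_r` is a highest-weight vector of `k[Sym^m k^σ]`** of weight
`-((m-1) r) ε_x - r ε_y` (the dual weight of the two-row partition `((m-1) r, r) ⊢ m r`), for `x` the
top letter, `y` its predecessor, `1 ≤ m`, `r ≤ m`, characteristic zero.  Proof: `(b · F_r)(q) =
F_r(b⁻¹ · q)`; restricted to `(y, x)`, `b⁻¹` acts by an upper triangular `2 × 2` matrix, and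
`α₀ F_r = T_r` is a seminvariant (`bs_tsch_linSubst`); the identity `(b · F_r - χ(b) F_r) · X₀ = 0` of
polynomial functions is checked pointwise (`MvPolynomial.funext`) and `X₀` is cancelled.
[folklore; Elliott 1895 §128] -/
theorem ts_tschPoly_mem_highestWeightSpace {σ : Type*} [Fintype σ] [LinearOrder σ] {K : Type*} [Field K]
    [CharZero K] {x y : σ} (hyx : y < x) (htop : ∀ i, i ≤ x)
    (hpred : ∀ i, i < x → i ≤ y) {m : ℕ} (hm1 : 1 ≤ m) {r : ℕ} (hr : r ≤ m) :
    (C ((Nat.choose m r : ℕ) : K) * (-X (⟨Finsupp.single y (min 1 m) + Finsupp.single x (m - min 1 m), ts_deg_mem x y m 1⟩ : DegIdx σ m)) ^ r + ∑ i ∈ Finset.range r, C ((Nat.choose (m - (i + 1)) (r - (i + 1)) * m ^ (i + 1) : ℕ) : K) * ((-X (⟨Finsupp.single y (min 1 m) + Finsupp.single x (m - min 1 m), ts_deg_mem x y m 1⟩ : DegIdx σ m)) ^ (r - (i + 1)) * X (⟨Finsupp.single y (min 0 m) + Finsupp.single x (m - min 0 m), ts_deg_mem x y m 0⟩ : DegIdx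 σ m) ^ i * X (⟨Finsupp.single y (min (i + 1) m) + Finsupp.single x (m - min (i + 1) m), ts_deg_mem x y m (i + 1)⟩ : DegIdx σ m))) ∈ highestWeightSpace (coordRep σ K m) (fun i : σ => if i = x then -(((m - 1) * r : ℕ) : ℤ) else if i = y then -((r : ℕ) : ℤ) else 0) := by
  have hne : y ≠ x := ne_of_lt hyx
  have hmK : ((m : ℕ) : K) ≠ 0 := Nat.cast_ne_zero.mpr (by omega)
  intro b hb
  rw [coordRep_apply]
  -- abbreviations
  set F : MvPolynomial (DegIdx σ m) K := (C ((Nat.choose m r : ℕ) : K) * (-X (⟨Finsupp.single y (min 1 m) + Finsupp.single x (m - min 1 m), ts_deg_mem x y m 1⟩ : DegIdx σ m)) ^ r + ∑ i ∈ Finset.range r, C ((Nat.choose (m - (i + 1)) (r - (i + 1)) * m ^ (i + 1) : ℕ) : K) * ((-X (⟨Finsupp.single y (min 1 m) + Finsupp.single x (m - min 1 m), ts_deg_mem x y m 1⟩ : DegIdx σ m)) ^ (r - (i + 1)) * X (⟨Finsupp.single y (min 0 m) + Finsupp.single x (m - min 0 m), ts_deg_mem x y m 0⟩ : DegIdx σ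 m) ^ i * X (⟨Finsupp.single y (min (i + 1) m) + Finsupp.single x (m - min (i + 1) m), ts_deg_mem x y m (i + 1)⟩ : DegIdx σ m))) with hF
  set c : K := weightChar (fun i : σ => if i = x then -(((m - 1) * r : ℕ) : ℤ) else if i = y then -((r : ℕ) : ℤ) else 0) b with hc
  -- the key identity of polynomial functions, multiplied by the coordinate `X₀`
  have key : (coordSubst m b F - c • F) * X (⟨Finsupp.single y (min 0 m) + Finsupp.single x (m - min 0 m), ts_deg_mem x y m 0⟩ : DegIdx σ m) = 0 := by
    apply MvPolynomial.funext
    intro w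
    obtain ⟨q, hq, rfl⟩ := exists_formCoeff_eq w
    change aeval (formCoeff m q) ((coordSubst m b F - c • F) * X (⟨Finsupp.single y (min 0 m) + Finsupp.single x (m - min 0 m), ts_deg_mem x y m 0⟩ : DegIdx σ m)) = aeval (formCoeff m q) 0
    have hb' : IsUpperTriangular b⁻¹ := (borelSubgroup σ K).inv_mem hb
    set B : Matrix σ σ K := ((b⁻¹ : GL σ K) : Matrix σ σ K) with hB
    have hBut : ∀ i j, j < i → B i j = 0 := fun i j hji => hb'.apply_eq_zero hji
    set q2 : MvPolynomial (Fin 2) K := (aeval fun i : σ => if i = x then (X 1 : MvPolynomial (Fin 2) K) else if i = y then (X 0 : MvPolynomial (Fin 2) K) else 0) q with hq2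
    have hq2h : q2.IsHomogeneous m := ts_res_isHomogeneous hq
    have hres : (aeval fun i : σ => if i = x then (X 1 : MvPolynomial (Fin 2) K) else if i = y then (X 0 : MvPolynomial (Fin 2) K) else 0) (linSubst σ K B q) = linSubst (Fin 2) K !![B y y, B y x; 0, B x x] q2 :=
      ts_res_linSubst hyx htop hpred B hBut q
    rw [map_zero, map_mul, map_sub, map_smul, aeval_X, ts_formCoeff_DI hne q (Nat.zero_le m),
      aeval_formCoeff_coordSubst, linSubstRep_apply, hF, ts_aeval_formCoeff_tschPoly hyx hm1 _ hr,
      ts_aeval_formCoeff_tschPoly hyx hm1 _ hr, ← hB, hres, ← hq2]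
    -- now a statement about the binary form `q2` and the upper triangular block of `b⁻¹`
    set B2 : Matrix (Fin 2) (Fin 2) K := !![B y y, B y x; 0, B x x] with hB2
    by_cases h0 : coeff (Finsupp.single 0 0 + Finsupp.single 1 (m - 0)) q2 = 0
    · rw [h0, mul_zero]
    have h11 : B2 1 1 ≠ 0 := by
      simp only [hB2, Matrix.of_apply, Matrix.cons_val', Matrix.cons_val_one, Matrix.cons_val_fin_one]
      exact diag_ne_zero_of_isUpperTriangular hb' x
    have hB210 : B2 1 0 = 0 := by simp [hB2]
    -- seminvariance of `T_r = α₀ · F_r`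
    have hT := bs_tsch_linSubst B2 hB210 h11 hq2h hm1 h0 hmK hr
    have e1 : coeff (Finsupp.single 0 0 + Finsupp.single 1 (m - 0)) (linSubst (Fin 2) K B2 q2) * (((Nat.choose m r : ℕ) : K) * (-(coeff (Finsupp.single 0 1 + Finsupp.single 1 (m - 1)) (linSubst (Fin 2) K B2 q2))) ^ r + ∑ i ∈ Finset.range r, ((Nat.choose (m - (i + 1)) (r - (i + 1)) * m ^ (i + 1) : ℕ) : K) * ((-(coeff (Finsupp.single 0 1 + Finsupp.single 1 (m - 1)) (linSubst (Fin 2) K B2 q2))) ^ (r - (i + 1)) * (coeff (Finsupp.single 0 0 + Finsupp.single 1 (m - 0)) (linSubst (Fin 2) K B2 q2)) ^ i * coeff (Finsupp.single 0 (i + 1) + Finsupp.single 1 (m - (i + 1))) (linSubst (Fin 2) K B2 q2))) =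
        B2 1 1 ^ ((m - 1) * r + m) * B2 0 0 ^ r * (coeff (Finsupp.single 0 0 + Finsupp.single 1 (m - 0)) q2 * (((Nat.choose m r : ℕ) : K) * (-(coeff (Finsupp.single 0 1 + Finsupp.single 1 (m - 1)) q2)) ^ r + ∑ i ∈ Finset.range r, ((Nat.choose (m - (i + 1)) (r - (i + 1)) * m ^ (i + 1) : ℕ) : K) * ((-(coeff (Finsupp.single 0 1 + Finsupp.single 1 (m - 1)) q2)) ^ (r - (i + 1)) * (coeff (Finsupp.single 0 0 + Finsupp.single 1 (m - 0)) q2) ^ i * coeff (Finsupp.single 0 (i + 1) + Finsupp.single 1 (m - (i + 1))) q2))) := by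
      rw [ts_coeff_zero_mul_val, ts_coeff_zero_mul_val]
      exact hT
    have e0 : coeff (Finsupp.single 0 0 + Finsupp.single 1 (m - 0)) (linSubst (Fin 2) K B2 q2) = B2 1 1 ^ m * coeff (Finsupp.single 0 0 + Finsupp.single 1 (m - 0)) q2 :=
      bs_coeff_zero_linSubst B2 hB210 hq2h
    -- cancel `α₀(B₂ q₂) = B₁₁^m α₀`
    have hval : (((Nat.choose m r : ℕ) : K) * (-(coeff (Finsupp.single 0 1 + Finsupp.single 1 (m - 1)) (linSubst (Fin 2) K B2 q2))) ^ r + ∑ i ∈ Finset.range r, ((Nat.choose (m - (i + 1)) (r - (i + 1)) * m ^ (i + 1) : ℕ) : K) * ((-(coeff (Finsupp.single 0 1 + Finsupp.single 1 (m - 1)) (linSubst (Fin 2) K B2 q2))) ^ (r - (i + 1)) * (coeff (Finsupp.single 0 0 + Finsupp.single 1 (m - 0)) (linSubst (Fin 2) K B2 q2)) ^ i * coeff (Finsupp.single 0 (i + 1) + Finsupp.single 1 (m - (i + 1))) (linSubst (Fin 2) K B2 q2))) = B2 1 1 ^ ((m - 1) * r) * B2 0 0 ^ r * (((Nat.choose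 m r : ℕ) : K) * (-(coeff (Finsupp.single 0 1 + Finsupp.single 1 (m - 1)) q2)) ^ r + ∑ i ∈ Finset.range r, ((Nat.choose (m - (i + 1)) (r - (i + 1)) * m ^ (i + 1) : ℕ) : K) * ((-(coeff (Finsupp.single 0 1 + Finsupp.single 1 (m - 1)) q2)) ^ (r - (i + 1)) * (coeff (Finsupp.single 0 0 + Finsupp.single 1 (m - 0)) q2) ^ i * coeff (Finsupp.single 0 (i + 1) + Finsupp.single 1 (m - (i + 1))) q2)) := by
      have hne0 : coeff (Finsupp.single 0 0 + Finsupp.single 1 (m - 0)) (linSubst (Fin 2) K B2 q2) ≠ 0 := by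
        rw [e0]; exact mul_ne_zero (pow_ne_zero _ h11) h0
      apply mul_left_cancel₀ hne0
      rw [e1, e0, pow_add]
      ring
    -- the character
    have hcval : c = B2 1 1 ^ ((m - 1) * r) * B2 0 0 ^ r := by
      rw [hc, ts_weightChar_twoRow hne m r b]
      simp only [hB2, hB, Matrix.of_apply, Matrix.cons_val', Matrix.cons_val_zero, Matrix.cons_val_one,
        Matrix.cons_val_fin_one, inv_apply_diag_of_isUpperTriangular' hb, inv_pow]
    rw [hval, hcval, smul_eq_mul]
    ring
  -- cancel the coordinate `X₀`
  rcases mul_eq_zero.mp key with h | h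
  · exact sub_eq_zero.mp h
  · exact absurd h (X_ne_zero _)

/-- The same in the coordinate ring of ANY orbit closure: the class of `F_r` in `k[Δ_m(f)]` is a
highest-weight vector of weight `-((m-1) r) ε_x - r ε_y` (the quotient map is `GL`-equivariant,
`mk_mem_highestWeightSpace_orbitCoordRep`). [folklore] -/
theorem ts_mk_tschPoly_mem_highestWeightSpace [CharZero K] {x y : σ} (hyx : y < x) (htop : ∀ i, i ≤ x)
    (hpred : ∀ i, i < x → i ≤ y) {m : ℕ} (hm1 : 1 ≤ m) {r : ℕ} (hr : r ≤ m) (f : MvPolynomial σ K)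
    (e : ℕ) :
    (Ideal.Quotient.mk (orbitVanishingIdeal f m) (C ((Nat.choose m r : ℕ) : K) * (-X (⟨Finsupp.single y (min 1 m) + Finsupp.single x (m - min 1 m), ts_deg_mem x y m 1⟩ : DegIdx σ m)) ^ r + ∑ i ∈ Finset.range r, C ((Nat.choose (m - (i + 1)) (r - (i + 1)) * m ^ (i + 1) : ℕ) : K) * ((-X (⟨Finsupp.single y (min 1 m) + Finsupp.single x (m - min 1 m), ts_deg_mem x y m 1⟩ : DegIdx σ m)) ^ (r - (i + 1)) * X (⟨Finsupp.single y (min 0 m) + Finsupp.single x (m - min 0 m), ts_deg_mem x y m 0⟩ : DegIdx σ m) ^ i * X (⟨Finsupp.single y (min (i + 1) m) + Finsupp.single x (m - min (i + 1) m), ts_deg_mem x y m (i + 1)⟩ : DegIdx σ m)))) ^ e ∈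
      highestWeightSpace (orbitCoordRep f m) (e • (fun i : σ => if i = x then -(((m - 1) * r : ℕ) : ℤ) else if i = y then -((r : ℕ) : ℤ) else 0)) := by
  rw [← map_pow]
  exact mk_mem_highestWeightSpace_orbitCoordRep f
    (pow_mem_highestWeightSpace_coordRep (ts_tschPoly_mem_highestWeightSpace hyx htop hpred hm1 hr) e)

end

end Summit.ValiantsHypothesis.ValiantsHypothesis.Theorems.ValuativeFlip
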